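import Mathlib.Analysis.Complex.Liouville
import Mathlib.Analysis.SpecialFunctions.Exponential
import Summits.QuantumFields.YangMills.Theorems.UnitScaleTiltProp8ChartBasePointGaugeLine
import Literature.MathematicalPhysics.QuantumFieldTheory.Balaban1983to89.B14Eq372ContourBCH
import HarnessLib

/-!
# K0⁷ STUB 1 (`stub_prop8StepCoP13`), sub-target S4b — LOCATED-BASEPOINT vs S4b, the SECOND-ORDER half CERTIFIED at the level of the chart REMAINDER:
# **THE SINGLE-BAR CHART REMAINDER `𝒞 − Qlin` ANSWERS THE η⁻¹-NORMALISED BASE-POINT MODE WITH `(i∕2)[M, Φ(c)]` UP TO `28(r‖M‖ + ‖Φ‖)³∕r`** —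
# for the chart `Prop8Chart.chartLog η D` of the SINGLE-bar (0.4) average, every fine site `y₀`, every field `Y` vanishing on the `2d` bonds at `y₀` at which the chart is
# differentiable and whose averaged bond variable `Ū^{(j)}(e^{iηY})(c)` is within `1∕80` of `1`, every index `i = (j,c)` centred over `y₀`, and the base-point mode
# `V = η⁻¹M(𝟙_{b₋=y₀} − 𝟙_{b₊=y₀})`: `‖D(chartLog)(Y)V i − D(chartLog)(0)V i − ½[M, iΦ]‖ ≤ 28(r‖M‖ + ‖Φ‖)³∕r`, `Φ = chartLog η D Y i`, any `r > 0` with `r‖M‖ ≤ 1∕40`;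
# with `‖M‖ = 1`, `r = ‖Φ‖`: the remainder's derivative along `V` has norm `≥ ½‖[M, Φ]‖ − 224‖Φ‖²` — an O(ρ) response to a mode of `w₁`-size `L^{j}‖M‖` spread on
# `2d` bonds, where a volume-suppressed per-bond kernel would give `O(ρ·L^{−3j})` (d = 4)

Cell `pub-ymgap`, width seat `pub-ymgap-k0-s1-w2` g4 (CLAIM-4; certified mechanism behind evidence #51 `LOCATED-BASEPOINT-S4B.md` (b) and ym3-torus RULING g26-№4 ∕ FINDING w8-1).
`--kind proof --supports stmt-QuantumFields-20541 --as helper`; count-neutral; def-free.  [15] = [Balaban1985Variational]; [B7] = [Balaban1985Averaging];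
[B14] = [Balaban1988Convergent].

WHY.  The S4b capstone's letter `θ₀` is the column letter of `𝔇(A′)ᵗ`, `𝔇 = (𝒞′_{X₀} − Qlin)(1 − H𝔇)` the derivative of the single-bar chart's nonlinear correction; UST certified
the FIRST-order base-point identity `Qlin V = M` (`ChartBasePointGaugeLine.fderiv_chartLog_zero_gaugeDir_src`) and the EXACT formula of the chart along the gauge line through
a field vanishing at `y₀`'s bonds, `chartLog η D (Y + sV) i = −i·log(e^{isM}·Ū^{(j)}(e^{iηY})(c))` (`chartLog_gaugeLine_src`), leaving the second-order extraction
«`𝒞′_Y V − Qlin V = (i∕2)[M, Φ(c)] + O(Φ²)`» at memo level.  THIS FILE certifies it: the two-factor second-order Baker–Campbell–Hausdorff bound of lit-balaban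
`B14.Eq372ContourBCH.norm_mlog_holonomy_sub_le` (‖log(e^Xe^Y) − X − Y − ½[X,Y]‖ ≤ 28(‖X‖+‖Y‖)³) along the complex line `z ↦ log(e^{zM}W)`, `W = e^{Y_W}`, `Y_W = log W = iΦ`,
bounds the remainder `R(z)` by `28(|z|‖M‖ + ‖Φ‖)³` on the circle `|z| = r`; `R(0) = 0` and `R` is holomorphic on the disc `|z| < 2r` (lit `analyticAt_mlog`), so Mathlib's Cauchy
estimate `Complex.norm_deriv_le_of_forall_mem_sphere_norm_le` gives `‖R′(0)‖ ≤ 28(r‖M‖ + ‖Φ‖)³∕r`; the chain rule through `s ↦ is` and the uniqueness of the real derivative of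
`s ↦ chartLog η D (Y + sV) i` identify `D(chartLog)(Y)V i` with `M + ½[M, iΦ] + R′(0)`.

WHAT IS PROVED (sorry-free; no definition; axioms standard; every complete normed `ℂ`-algebra `𝔸`, every torus `P`, nested `D`, `η ≠ 0`).
* §1 `norm_exp_smul_mul_sub_one_le` (`‖e^{zM}W − 1‖ ≤ (e^{|z|‖M‖} − 1)‖W‖ + ‖W − 1‖`), `norm_exp_smul_mul_sub_one_lt_one` (the disc `|z| ≤ 2r` stays in the log chart),
  ★★ `exists_hasDerivAt_mlog_expLine` — `r > 0`, `r‖M‖ ≤ 1∕40`, `‖W − 1‖ ≤ 1∕80` ⇒ `∃ D, HasDerivAt (z ↦ log(e^{zM}W)) D 0 ∧ ‖D − (M + ½[M, log W])‖ ≤ 28(r‖M‖ + ‖log W‖)³∕r`.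
* §2 ★★★ `fderiv_chartLog_gaugeDir_sub_le` — the displayed inequality for `Prop8Chart.chartLog` (hypotheses: `Y` vanishes on the `2d` bonds at `y₀`, `chartLog η D` is
  ℂ-differentiable at `Y` — dag-n07-w2's `N07ChartLogAnalytic` on the weighted ball —, `‖Ū^{(j)}(e^{iηY})(c) − 1‖ ≤ 1∕80`, `embIter j c₋ = y₀ ≠ embIter j c₊`, `r‖M‖ ≤ 1∕40`).
* §2 ★★ `norm_fderiv_chartRemainder_gaugeDir_ge` — `‖M‖ = 1`, `0 < ‖Φ‖ ≤ 1∕40` ⇒ `‖D(chartLog)(Y)V i − D(chartLog)(0)V i‖ ≥ ½‖MΦ − ΦM‖ − 224‖Φ‖²`.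
HONEST SCOPE.  A certified identity-with-remainder about the single-bar chart's REMAINDER `𝒞 − Qlin` along ONE direction; it is the mechanism of LOCATED-BASEPOINT (b), NOT yet a
statement about the implicit chart `D(·)`∕`𝔇` of (47)–(49) (that needs the Neumann-series step `𝔇 = (1 + R′H)⁻¹R′` at kernel level — dag-n07-w2's lane) nor about `θ₀`∕`C₄`
themselves; nothing landed is claimed false; which chart the K0 road uses is the planners' ruling; `stub_prop8StepCoP13` ∕ K0⁷ NOT closed; N07 NOT discharged; counts unmoved
(28∕28 · 5∕27); one finite 𝕋⁴ programme at fixed ε — R4 closes the conditional finite-𝕋⁴ rung `BalabanLadder.UV` only, never the summit; the YM mass gap (Clay) is NOT proved by any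
of this; nothing continuum ∕ ℝ⁴ ∕ OS.  No `sorry`, no `def`, no `instance`, no `notation`.

References: [15] (44)–(49) p.285, (68)–(73) pp.288–289, (156)–(157) p.302; [B7] (8)–(11) pp.18–19, (21) p.21, (28)–(31) pp.21–22, (89) p.31, (125) p.36, (147)∕(157) pp.40–42;
[B14] (3.71)–(3.72) p.284; [Balaban1987RG1] (0.4) p.253.
-/

set_option autoImplicit false

noncomputable section

open scoped BigOperators Topology
open NormedSpace Metric Set Filter

namespace Summit.QuantumFields.YangMills.Theorems.K0Stub1ChartRemainderBasePoint

open Literature.MathematicalPhysics.QuantumFieldTheory.Balaban1983to89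
open Literature.MathematicalPhysics.QuantumFieldTheory.Balaban1983to89.MatrixLog (mlog exp_mlog analyticAt_mlog norm_mlog_le_two_mul)
open Literature.MathematicalPhysics.QuantumFieldTheory.Balaban1983to89.B14.Eq372ContourBCH (holonomy contourVar pairComm normSum norm_mlog_holonomy_sub_le)
open B6SectADomainsV1 (Domains)
open B6SectAOperatorsV1 (BondIdx)
open B15DeterminingSets (embIter)
open Summit.QuantumFields.YangMills.Theorems.Prop8Chart (chartLog chartLog_apply expCfg emlIterU)
open Summit.QuantumFields.YangMills.Theorems.ChartBasePointGaugeLine (fderiv_chartLog_zero_gaugeDir_src chartLog_gaugeLine_src)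

variable {𝔸 : Type*} [NormedRing 𝔸] [NormedAlgebra ℂ 𝔸] [CompleteSpace 𝔸]

/-! ## §1  The complex line `z ↦ log(e^{zM}W)` through a point `W` of the log chart: second-order BCH + Cauchy -/

/-- `‖e^{zM}W − 1‖ ≤ (e^{|z|‖M‖} − 1)(1 + ‖W − 1‖) + ‖W − 1‖` (no `‖1‖` needed: `e^{zM}W − 1 = (e^{zM} − 1)(W − 1) + (e^{zM} − 1) + (W − 1)`). [folklore] -/
theorem norm_exp_smul_mul_sub_one_le (M W : 𝔸) (z : ℂ) :
    ‖exp (z • M) * W - 1‖ ≤ (Real.exp (‖z‖ * ‖M‖) - 1) * (1 + ‖W - 1‖) + ‖W - 1‖ := by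
  have h1 : exp (z • M) * W - 1 = ((exp (z • M) - 1) * (W - 1) + (exp (z • M) - 1)) + (W - 1) := by noncomm_ring
  rw [h1]
  have he : ‖exp (z • M) - 1‖ ≤ Real.exp (‖z‖ * ‖M‖) - 1 := by
    refine (Literature.Analysis.Calculus.norm_exp_sub_one_le (z • M)).trans ?_
    rw [norm_smul]
  have he0 : 0 ≤ Real.exp (‖z‖ * ‖M‖) - 1 := by
    have := Real.add_one_le_exp (‖z‖ * ‖M‖); nlinarith [norm_nonneg z, norm_nonneg M, mul_nonneg (norm_nonneg z) (norm_nonneg M)]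
  refine (norm_add_le _ _).trans (add_le_add ?_ le_rfl)
  refine (norm_add_le _ _).trans ?_
  have h2 : ‖(exp (z • M) - 1) * (W - 1)‖ ≤ (Real.exp (‖z‖ * ‖M‖) - 1) * ‖W - 1‖ :=
    (norm_mul_le _ _).trans (mul_le_mul_of_nonneg_right he (norm_nonneg _))
  calc ‖(exp (z • M) - 1) * (W - 1)‖ + ‖exp (z • M) - 1‖
      ≤ (Real.exp (‖z‖ * ‖M‖) - 1) * ‖W - 1‖ + (Real.exp (‖z‖ * ‖M‖) - 1) := add_le_add h2 he
    _ = (Real.exp (‖z‖ * ‖M‖) - 1) * (1 + ‖W - 1‖) := by ring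

/-- the disc `|z| ≤ 2r` stays inside the log chart: `r‖M‖ ≤ 1∕40`, `‖W − 1‖ ≤ 1∕80`, `‖z‖ ≤ 2r` ⇒ `‖e^{zM}W − 1‖ < 1` (indeed `≤ 1∕5`). [folklore] -/
theorem norm_exp_smul_mul_sub_one_lt_one (M W : 𝔸) {r : ℝ} (hM : r * ‖M‖ ≤ 1 / 40) (hW : ‖W - 1‖ ≤ 1 / 80) {z : ℂ} (hz : ‖z‖ ≤ 2 * r) :
    ‖exp (z • M) * W - 1‖ < 1 := by
  have h := norm_exp_smul_mul_sub_one_le M W z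
  have hzM : ‖z‖ * ‖M‖ ≤ 1 / 20 := by
    calc ‖z‖ * ‖M‖ ≤ 2 * r * ‖M‖ := mul_le_mul_of_nonneg_right hz (norm_nonneg _)
      _ = 2 * (r * ‖M‖) := by ring
      _ ≤ 1 / 20 := by linarith
  have hzM0 : 0 ≤ ‖z‖ * ‖M‖ := mul_nonneg (norm_nonneg _) (norm_nonneg _)
  have hexp : Real.exp (‖z‖ * ‖M‖) - 1 ≤ 2 * (‖z‖ * ‖M‖) := by
    have h1 : |‖z‖ * ‖M‖| ≤ 1 := by rw [abs_of_nonneg hzM0]; linarith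
    have h2 := Real.abs_exp_sub_one_le h1
    rw [abs_of_nonneg hzM0] at h2
    exact (le_abs_self _).trans h2
  have hb0 : 0 ≤ ‖W - 1‖ := norm_nonneg _
  calc ‖exp (z • M) * W - 1‖ ≤ (Real.exp (‖z‖ * ‖M‖) - 1) * (1 + ‖W - 1‖) + ‖W - 1‖ := h
    _ ≤ (2 * (‖z‖ * ‖M‖)) * (1 + 1 / 80) + 1 / 80 :=
        add_le_add (mul_le_mul hexp (by linarith) (by positivity) (by positivity)) hW
    _ ≤ (2 * (1 / 20 : ℝ)) * (1 + 1 / 80) + 1 / 80 := by nlinarith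
    _ < 1 := by norm_num

/-- ★★ **THE DERIVATIVE OF `z ↦ log(e^{zM}W)` AT `0` IS `M + ½[M, log W]` UP TO `28(r‖M‖ + ‖log W‖)³∕r`.**  For `r > 0` with `r‖M‖ ≤ 1∕40` and `‖W − 1‖ ≤ 1∕80`
(so `log W` is defined with `‖log W‖ ≤ 1∕40` and `e^{log W} = W`): the second-order BCH bound of [B14] (3.72) ([B7] (28)–(31)) on the circle `|z| = r` plus the Cauchy estimate.
[cite: Balaban1985Averaging, (21) p.21, (28)-(31) pp.21-22; Balaban1988Convergent, (3.72) p.284] -/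
theorem exists_hasDerivAt_mlog_expLine (M W : 𝔸) {r : ℝ} (hr : 0 < r) (hM : r * ‖M‖ ≤ 1 / 40) (hW : ‖W - 1‖ ≤ 1 / 80) :
    ∃ D : 𝔸, HasDerivAt (fun z : ℂ => mlog (exp (z • M) * W)) D 0 ∧
      ‖D - (M + (2⁻¹ : ℂ) • (M * mlog W - mlog W * M))‖ ≤ 28 * (r * ‖M‖ + ‖mlog W‖) ^ 3 / r := by
  -- the logarithm of `W`
  set Y : 𝔸 := mlog W with hYdef
  have hW1 : ‖W - 1‖ < 1 := by linarith
  have hY2 : ‖Y‖ ≤ 2 * ‖W - 1‖ := norm_mlog_le_two_mul (by linarith)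
  have hYs : ‖Y‖ ≤ 1 / 40 := by linarith
  have hexpY : exp Y = W := exp_mlog hW1
  -- the curve and the polynomial part
  set g : ℂ → 𝔸 := fun z => exp (z • M) * W with hgdef
  set p : ℂ → 𝔸 := fun z => (z • M + Y) + (2⁻¹ : ℂ) • (z • M * Y - Y * (z • M)) with hpdef
  set R : ℂ → 𝔸 := fun z => mlog (g z) - p z with hRdef
  have hg : ∀ z : ℂ, HasDerivAt g (M * exp (z • M) * W) z := fun z =>
    (hasDerivAt_exp_smul_const' (𝕂 := ℂ) M z).mul_const W
  have hline : ∀ z : ℂ, HasDerivAt (fun z : ℂ => z • M) M z := fun z => by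
    simpa using (hasDerivAt_id z).smul_const M
  have hp : HasDerivAt p (M + (2⁻¹ : ℂ) • (M * Y - Y * M)) 0 := by
    have h1 : HasDerivAt (fun z : ℂ => z • M + Y) M 0 := by simpa using (hline 0).add_const Y
    have h2 : HasDerivAt (fun z : ℂ => z • M * Y - Y * (z • M)) (M * Y - Y * M) 0 :=
      ((hline 0).mul_const Y).sub ((hline 0).const_mul Y)
    have h3 := h1.add (h2.const_smul (2⁻¹ : ℂ))
    exact h3
  -- differentiability of `log ∘ g` on the disc `|z| < 2r`
  have hdiffAt : ∀ z : ℂ, ‖z‖ ≤ 2 * r → DifferentiableAt ℂ (fun z : ℂ => mlog (g z)) z := by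
    intro z hz
    have hin : ‖g z - 1‖ < 1 := norm_exp_smul_mul_sub_one_lt_one M W hM hW hz
    exact (analyticAt_mlog hin).differentiableAt.comp z (hg z).differentiableAt
  have hRdiff : DifferentiableOn ℂ R (ball (0 : ℂ) (2 * r)) := by
    intro z hz
    have hz' : ‖z‖ ≤ 2 * r := by rw [mem_ball, dist_zero_right] at hz; exact hz.le
    exact ((hdiffAt z hz').sub (((hline z).add_const Y).add
      ((((hline z).mul_const Y).sub ((hline z).const_mul Y)).const_smul (2⁻¹ : ℂ))).differentiableAt).differentiableWithinAt
  -- the BCH bound on the circle `|z| = r`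
  have hRbound : ∀ z ∈ sphere (0 : ℂ) r, ‖R z‖ ≤ 28 * (r * ‖M‖ + ‖Y‖) ^ 3 := by
    intro z hz
    rw [mem_sphere, dist_zero_right] at hz
    have hzM : ‖z • M‖ = r * ‖M‖ := by rw [norm_smul, hz]
    have hsum : normSum [z • M, Y] = r * ‖M‖ + ‖Y‖ := by simp [normSum, hzM]
    have hsmall : normSum [z • M, Y] ≤ 1 / 20 := by rw [hsum]; linarith
    have hbch := norm_mlog_holonomy_sub_le [z • M, Y] hsmall
    have hhol : holonomy [z • M, Y] = g z := by simp [holonomy, hgdef, hexpY]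
    have hcv : contourVar [z • M, Y] = z • M + Y := by simp [contourVar]
    have hpc : pairComm [z • M, Y] = z • M * Y - Y * (z • M) := by simp [pairComm]
    rw [hhol, hcv, hpc, hsum] at hbch
    have hRz : R z = mlog (g z) - (z • M + Y) - (2⁻¹ : ℂ) • (z • M * Y - Y * (z • M)) := by
      simp only [hRdef, hpdef]; abel
    rw [hRz]
    exact hbch
  -- Cauchy's estimate for `R′(0)`
  have hsub : closedBall (0 : ℂ) r ⊆ ball (0 : ℂ) (2 * r) := closedBall_subset_ball (by linarith)
  have hCauchy : ‖deriv R 0‖ ≤ 28 * (r * ‖M‖ + ‖Y‖) ^ 3 / r :=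
    Complex.norm_deriv_le_of_forall_mem_sphere_norm_le hr (hRdiff.diffContOnCl_ball hsub) hRbound
  -- the derivative of `log ∘ g` at `0`
  have hD : HasDerivAt (fun z : ℂ => mlog (g z)) (deriv (fun z : ℂ => mlog (g z)) 0) 0 :=
    (hdiffAt 0 (by rw [norm_zero]; positivity)).hasDerivAt
  have hRderiv : deriv R 0 = deriv (fun z : ℂ => mlog (g z)) 0 - (M + (2⁻¹ : ℂ) • (M * Y - Y * M)) := (hD.sub hp).deriv
  refine ⟨deriv (fun z : ℂ => mlog (g z)) 0, hD, ?_⟩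
  rw [← hRderiv]
  exact hCauchy

/-! ## §2  The single-bar chart along the base-point gauge line through a point: the remainder's derivative -/

variable {P : Params}

/-- ★★★ **THE SINGLE-BAR CHART REMAINDER ANSWERS THE BASE-POINT MODE WITH `½[M, iΦ(c)]` UP TO `28(r‖M‖ + ‖Φ‖)³∕r`.**  For `η ≠ 0`, a nested family `D`, a fine site `y₀`,
`M : 𝔸`, a field `Y` vanishing on the `2d` bonds at `y₀` at which `chartLog η D` is ℂ-differentiable and whose single-bar averaged bond variable `W = Ū^{(j)}(e^{iηY})(c)` has
`‖W − 1‖ ≤ 1∕80`, an index `i = (j,c)` with `embIter j c₋ = y₀ ≠ embIter j c₊`, and `r > 0` with `r‖M‖ ≤ 1∕40`: writing `Φ := chartLog η D Y i` (so `log W = iΦ`) and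
`V := η⁻¹M(𝟙_{b₋=y₀} − 𝟙_{b₊=y₀})`,
`‖D(chartLog η D)(Y) V i − D(chartLog η D)(0) V i − ½(M·(iΦ) − (iΦ)·M)‖ ≤ 28(r‖M‖ + ‖Φ‖)³∕r` — the linear chart answers `M` (UST `fderiv_chartLog_zero_gaugeDir_src`), the
chart at `Y` answers `M + ½[M, iΦ] + O(Φ²)` (§1 along `chartLog_gaugeLine_src`).
[cite: Balaban1985Averaging, (11) p.19, (21) p.21, (28)-(31) pp.21-22, (125) p.36, (147) p.40; Balaban1985Variational, (44)-(47) p.285, (72)-(73) p.289, (156)-(157) p.302; Balaban1988Convergent, (3.72) p.284] -/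
theorem fderiv_chartLog_gaugeDir_sub_le {η : ℝ} (hη : η ≠ 0) (D : Domains P) (y₀ : Site P 0) (M : 𝔸) (Y : PBond P 0 → 𝔸)
    (hY : ∀ b : PBond P 0, b.src = y₀ ∨ b.tgt = y₀ → Y b = 0) (i : BondIdx D)
    (hsrc : embIter (i.1.1 : ℕ) i.1.2.src = y₀) (htgt : embIter (i.1.1 : ℕ) i.1.2.tgt ≠ y₀)
    (hdiff : DifferentiableAt ℂ (chartLog η D : (PBond P 0 → 𝔸) → BondIdx D → 𝔸) Y)
    (hW : ‖((emlIterU (i.1.1 : ℕ) (expCfg η Y) i.1.2 : 𝔸ˣ) : 𝔸) - 1‖ ≤ 1 / 80)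
    {r : ℝ} (hr : 0 < r) (hM : r * ‖M‖ ≤ 1 / 40) :
    ‖fderiv ℂ (chartLog η D : (PBond P 0 → 𝔸) → BondIdx D → 𝔸) Y
          (fun b : PBond P 0 => (if b.src = y₀ then ((η⁻¹ : ℝ) : ℂ) • M else 0) - (if b.tgt = y₀ then ((η⁻¹ : ℝ) : ℂ) • M else 0)) i
        - fderiv ℂ (chartLog η D : (PBond P 0 → 𝔸) → BondIdx D → 𝔸) 0
          (fun b : PBond P 0 => (if b.src = y₀ then ((η⁻¹ : ℝ) : ℂ) • M else 0) - (if b.tgt = y₀ then ((η⁻¹ : ℝ) : ℂ) • M else 0)) i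
        - (2⁻¹ : ℂ) • (M * (Complex.I • chartLog η D Y i) - (Complex.I • chartLog η D Y i) * M)‖
      ≤ 28 * (r * ‖M‖ + ‖chartLog η D Y i‖) ^ 3 / r := by
  set V : PBond P 0 → 𝔸 := fun b => (if b.src = y₀ then ((η⁻¹ : ℝ) : ℂ) • M else 0) - (if b.tgt = y₀ then ((η⁻¹ : ℝ) : ℂ) • M else 0) with hV
  set W : 𝔸 := ((emlIterU (i.1.1 : ℕ) (expCfg η Y) i.1.2 : 𝔸ˣ) : 𝔸) with hWdef
  -- `log W = iΦ`
  have hlogW : mlog W = Complex.I • chartLog η D Y i := by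
    rw [chartLog_apply, smul_smul, ← hWdef]
    simp
  have hnormΦ : ‖mlog W‖ = ‖chartLog η D Y i‖ := by rw [hlogW, norm_smul, Complex.norm_I, one_mul]
  -- §1: the derivative `D₀` of `z ↦ log(e^{zM}W)` at `0`
  obtain ⟨D₀, hD₀, hbound⟩ := exists_hasDerivAt_mlog_expLine M W hr hM hW
  -- the real line `s ↦ chartLog η D (Y + sV) i`
  set F : (PBond P 0 → 𝔸) → 𝔸 := fun A => chartLog η D A i with hF
  have hFd : DifferentiableAt ℂ F Y := differentiableAt_pi.1 hdiff i
  have hFderiv : fderiv ℂ F Y V = fderiv ℂ (chartLog η D : (PBond P 0 → 𝔸) → BondIdx D → 𝔸) Y V i := by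
    rw [hF, fderiv_apply hdiff i]
    rfl
  have hlineR : HasDerivAt (fun s : ℝ => Y + ((s : ℝ) : ℂ) • V) V 0 := by
    have h := (Complex.ofRealCLM.hasDerivAt (x := (0 : ℝ))).smul_const V
    simpa using h.const_add Y
  have hcomp : HasDerivAt (fun s : ℝ => F (Y + ((s : ℝ) : ℂ) • V)) (fderiv ℂ F Y V) 0 := by
    have hF' : HasFDerivAt F ((fderiv ℂ F Y).restrictScalars ℝ) (Y + ((0 : ℝ) : ℂ) • V) := by
      rw [Complex.ofReal_zero, zero_smul, add_zero]; exact hFd.hasFDerivAt.restrictScalars ℝ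
    have h := hF'.comp_hasDerivAt (0 : ℝ) hlineR
    simpa only [Function.comp_def, ContinuousLinearMap.coe_restrictScalars'] using h
  -- but along the line `F` is `s ↦ −i·log(e^{isM}W)` (exact base-point covariance), whose derivative at `0` is `D₀`
  have hexact : ∀ s : ℝ, F (Y + ((s : ℝ) : ℂ) • V) = (-Complex.I) • mlog (exp ((Complex.I * (s : ℂ)) • M) * W) :=
    fun s => chartLog_gaugeLine_src hη D y₀ M s Y hY i hsrc htgt
  have hinner : HasDerivAt (fun s : ℝ => Complex.I * ((s : ℝ) : ℂ)) Complex.I 0 := by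
    simpa using (Complex.ofRealCLM.hasDerivAt (x := (0 : ℝ))).const_mul Complex.I
  have houter : HasDerivAt (fun z : ℂ => mlog (exp (z • M) * W)) D₀ (Complex.I * (((0 : ℝ)) : ℂ)) := by
    rw [Complex.ofReal_zero, mul_zero]; exact hD₀
  have hchain : HasDerivAt (fun s : ℝ => mlog (exp ((Complex.I * ((s : ℝ) : ℂ)) • M) * W)) (Complex.I • D₀) 0 := by
    have h := houter.scomp (0 : ℝ) hinner
    simpa only [Function.comp_def] using h
  have hlin : HasDerivAt (fun s : ℝ => F (Y + ((s : ℝ) : ℂ) • V)) ((-Complex.I) • (Complex.I • D₀)) 0 := by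
    have h := hchain.const_smul (-Complex.I)
    refine h.congr_of_eventuallyEq ?_
    exact Filter.Eventually.of_forall fun s => hexact s
  have hII : (-Complex.I) • (Complex.I • D₀) = D₀ := by
    rw [smul_smul, neg_mul, Complex.I_mul_I, neg_neg, one_smul]
  rw [hII] at hlin
  -- uniqueness of the derivative: `D(chartLog)(Y) V i = D₀`; at `0`: `= M`
  have hYV : fderiv ℂ (chartLog η D : (PBond P 0 → 𝔸) → BondIdx D → 𝔸) Y V i = D₀ := by
    rw [← hFderiv]; exact hcomp.unique hlin
  have h0V : fderiv ℂ (chartLog η D : (PBond P 0 → 𝔸) → BondIdx D → 𝔸) 0 V i = M :=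
    fderiv_chartLog_zero_gaugeDir_src hη D y₀ M i hsrc htgt
  rw [hYV, h0V, ← hlogW, ← hnormΦ]
  have hrw : D₀ - M - (2⁻¹ : ℂ) • (M * mlog W - mlog W * M) = D₀ - (M + (2⁻¹ : ℂ) • (M * mlog W - mlog W * M)) := by abel
  rw [hrw]
  exact hbound

/-- ★★ **COROLLARY — THE BASE-POINT LEVERAGE OF THE SINGLE-BAR REMAINDER, LOWER BOUND.**  Under the hypotheses of `fderiv_chartLog_gaugeDir_sub_le` with a unit test matrix
`‖M‖ = 1` and `0 < ‖Φ‖ ≤ 1∕40` (`Φ = chartLog η D Y i`), taking `r = ‖Φ‖`: the REMAINDER `𝒞 − Qlin` of the single-bar chart has, along the η⁻¹-normalised base-point mode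
`V`, a derivative at `Y` of norm `≥ ½‖MΦ − ΦM‖ − 224‖Φ‖²` at the index `i` — first order in `‖Φ‖ ≍ ρ` whenever `[M, Φ(c)] ≠ 0`, with NO volume factor `L^{−3j}`.
[cite: Balaban1985Averaging, (125) p.36, (147) p.40, (157) p.42; Balaban1985Variational, (72)-(73) p.289] -/
theorem norm_fderiv_chartRemainder_gaugeDir_ge {η : ℝ} (hη : η ≠ 0) (D : Domains P) (y₀ : Site P 0) (M : 𝔸) (hM1 : ‖M‖ = 1)
    (Y : PBond P 0 → 𝔸) (hY : ∀ b : PBond P 0, b.src = y₀ ∨ b.tgt = y₀ → Y b = 0) (i : BondIdx D)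
    (hsrc : embIter (i.1.1 : ℕ) i.1.2.src = y₀) (htgt : embIter (i.1.1 : ℕ) i.1.2.tgt ≠ y₀)
    (hdiff : DifferentiableAt ℂ (chartLog η D : (PBond P 0 → 𝔸) → BondIdx D → 𝔸) Y)
    (hW : ‖((emlIterU (i.1.1 : ℕ) (expCfg η Y) i.1.2 : 𝔸ˣ) : 𝔸) - 1‖ ≤ 1 / 80)
    (hΦ0 : 0 < ‖chartLog η D Y i‖) (hΦ : ‖chartLog η D Y i‖ ≤ 1 / 40) :
    2⁻¹ * ‖M * chartLog η D Y i - chartLog η D Y i * M‖ - 224 * ‖chartLog η D Y i‖ ^ 2 ≤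
      ‖fderiv ℂ (chartLog η D : (PBond P 0 → 𝔸) → BondIdx D → 𝔸) Y
          (fun b : PBond P 0 => (if b.src = y₀ then ((η⁻¹ : ℝ) : ℂ) • M else 0) - (if b.tgt = y₀ then ((η⁻¹ : ℝ) : ℂ) • M else 0)) i
        - fderiv ℂ (chartLog η D : (PBond P 0 → 𝔸) → BondIdx D → 𝔸) 0
          (fun b : PBond P 0 => (if b.src = y₀ then ((η⁻¹ : ℝ) : ℂ) • M else 0) - (if b.tgt = y₀ then ((η⁻¹ : ℝ) : ℂ) • M else 0)) i‖ := by
  set Φ := chartLog η D Y i with hΦdef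
  have hr : 0 < ‖Φ‖ := hΦ0
  have hrM : ‖Φ‖ * ‖M‖ ≤ 1 / 40 := by rw [hM1, mul_one]; exact hΦ
  have h := fderiv_chartLog_gaugeDir_sub_le hη D y₀ M Y hY i hsrc htgt hdiff hW hr hrM
  -- the commutator term: `‖½(M·iΦ − iΦ·M)‖ = ½‖MΦ − ΦM‖`
  have hcomm : ‖(2⁻¹ : ℂ) • (M * (Complex.I • Φ) - (Complex.I • Φ) * M)‖ = 2⁻¹ * ‖M * Φ - Φ * M‖ := by
    have : M * (Complex.I • Φ) - (Complex.I • Φ) * M = Complex.I • (M * Φ - Φ * M) := by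
      rw [mul_smul_comm, smul_mul_assoc, smul_sub]
    rw [this, smul_smul, norm_smul, norm_mul, Complex.norm_I, mul_one, norm_inv, Complex.norm_ofNat]
  -- the error term at `r = ‖Φ‖`: `28(2‖Φ‖)³∕‖Φ‖ = 224‖Φ‖²`
  have herr : 28 * (‖Φ‖ * ‖M‖ + ‖Φ‖) ^ 3 / ‖Φ‖ = 224 * ‖Φ‖ ^ 2 := by
    rw [hM1, mul_one]; field_simp; ring
  rw [herr] at h
  -- reverse triangle inequality
  set A := fderiv ℂ (chartLog η D : (PBond P 0 → 𝔸) → BondIdx D → 𝔸) Y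
          (fun b : PBond P 0 => (if b.src = y₀ then ((η⁻¹ : ℝ) : ℂ) • M else 0) - (if b.tgt = y₀ then ((η⁻¹ : ℝ) : ℂ) • M else 0)) i
        - fderiv ℂ (chartLog η D : (PBond P 0 → 𝔸) → BondIdx D → 𝔸) 0
          (fun b : PBond P 0 => (if b.src = y₀ then ((η⁻¹ : ℝ) : ℂ) • M else 0) - (if b.tgt = y₀ then ((η⁻¹ : ℝ) : ℂ) • M else 0)) i with hA
  set C := (2⁻¹ : ℂ) • (M * (Complex.I • Φ) - (Complex.I • Φ) * M) with hC
  have hAC : ‖A - C‖ ≤ 224 * ‖Φ‖ ^ 2 := h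
  have hrev : ‖C‖ - ‖A‖ ≤ ‖A - C‖ := by
    have := norm_sub_norm_le C A
    rwa [norm_sub_rev C A] at this
  rw [hcomm] at hrev
  linarith

end Summit.QuantumFields.YangMills.Theorems.K0Stub1ChartRemainderBasePoint

end
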